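import Literature.MathematicalPhysics.QuantumFieldTheory.Balaban1983to89.B1Eq324BenfattoClassSectEMemberPrecisionDoorIneq2153AtOne
import Literature.MathematicalPhysics.QuantumFieldTheory.Balaban1983to89.B9DeltaAOneCoerciveOneLevelY
import Literature.MathematicalPhysics.QuantumFieldTheory.Balaban1983to89.Node00.OpsYSectEStarGeometry

/-!
# `Balaban1983to89.B1Eq324BenfattoClassSectEMemberIneq2153ScalarReductionAtNode00` — THE Δ_k-ROW OF THE `U = 1` PRECISION DOOR IS A SCALAR STATEMENT:
# p. 428's *"a lower bound γ₀ > 0 … We have proved it in [4], Lemma 2.4, for operators with U = 1"* read where [4] proves it — on REAL bond functions, for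
# [4]'s own `(QGQ*)⁻¹ − a` on NODE 00's carrier `BondIdx (domT …)`: the matrix-valued Δ_k-row the (3.24) doors display at `U = 1` (n08-b's p683587,
# `trIP 1`-pairing of the print-unit letter `deltaKPY … 1` on `bonds → M_N(ℂ)`) FOLLOWS FROM the scalar (2.153)-row, for ANY description of print's
# constrained subspace (vanishing set `Z`, `Q(1)`-constraint set `S`) — so the repaired door (dag-n08-b CHECK-L: [4]'s STAR reading of «c ∈ Λ′») is served verbatim
# (seat dag-n08-d gen 37, INTENT-91; node N08 [Balaban1985UV3], row `h324c`; node00-def-Y LOCATED-D153 piece D4 «n08 lane» with the fibre junction D2 inlined)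

statement-level companion of published sources with citation tags; every declaration here is a theorem; nothing here is a claim about the
Yang–Mills mass gap

THE PRINTED LOCUS.  [Balaban1985BackgroundPropagators] (= [B9]) Sect. E p. 428: *"⟨B,(QG₁Q\*)⁻¹B⟩ − a⟨B,B⟩ − 2⟨H₁D̃⁽²⁾(B),J⟩ = ⟨B,Δ_kB⟩. (3.156)  This
form is considered on the subspace {B : B = 0 on Λᶜ, B = 0 on ⋃_{y∈Λ′} Ax(y), Q₁B = 0} … a positive definite operator C\*Δ_kC with a lower bound γ₀ > 0
independent of k and U. We have proved it in [4], Lemma 2.4, for operators with U = 1."*; Cor. 3.5 p. 407: *"for U = 1 these theorems are proved in [4]"*.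
[Balaban1984PropagatorsII] (= [4]) p. 249: *"Using (2.118) and (2.128) we get ⟨B, Δ_kB⟩ ≥ (γ₀∕12d²)L^{−d−1}‖B‖², or Δ_k ≥ (γ₀∕12d²)L^{−d−1} (2.153) on the
subspace of B satisfying: QB = 0, B(Γ_{y,x}) = 0 for x ∈ B(y)"*; p. 224 (2.3): *"Ω also the set of bonds ⋃_{x∈Ω} st(x) = {b : at least one end-point of b
belongs to Ω}"*, and Lemma 2.4 p. 245: *"We denote by Λ also a set of bonds b such that at least one of the end-points b₋, b₊ belongs to Λ"*; p. 228 (2.35):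
*"The operator G is positive, hence QGQ\* is positive also and an inverse is a well-defined and positive operator"*; the fields are 𝔤-valued and every norm ∕
scalar product of [4] Sect. 2 is the sum over a basis of 𝔤 of the scalar ones ((2.14), (2.69) p. 235), the inequalities being proved component by component.
[Balaban1985Averaging] (125) p. 36 (the linear form `Q(V)`, whose `V = 1` value is the plain block–segment average).  [Balaban1985UV3] (24) p. 262, pp. 271–272
(row `h324c`); [Balaban1982Higgs1] (3.24) p. 616; [BenfattoEtAl1978] Lemma (4.5)–(4.7) p. 152.

WHY THIS MODULE (cell `pub-ymgap`, seat `dag-n08-d` gen 37, INTENT-91; node00-def-Y LOCATED-D153, bus 2026-08-29T00:54Z, split the located `U = 1`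
Δ_k-row into D1 carriers ∕ D2 fibre ∕ D3 the scalar inequality itself (node N06 ∕ cell `pub-balaban`, XL; dag-n08-b CLAIM-16 (A)(B) took it natively on V1)
∕ D4 composition «n08 lane»; this is D4 with D2 inlined, D1 not needed).  After p683587 the `U = 1` edition of the (3.24) precision door holds MODULO one
displayed row: [4] (2.153) for def-Y's print-unit letter `deltaKPY … 1 = η^{d+1}(QG₁Q\*)⁻¹(1) − η^{d+1}a` — a `ℂ`-linear operator on `M_N(ℂ)`-VALUED bond
functions, paired by the weight-one real trace pairing `trIP 1`.  But at `U = 1` every letter in it is the LIFT of a REAL scalar operator on NODE 00's carrier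
`IBondY = BondIdx (domT …)`: n06-i's `B9Eq3132SectDLetters.QGQinvY_one_liftEndY` with def-Y's `OpsYSectDE.QG1QinvY_one` give `(QG₁Q\*)⁻¹(1) = (QGQ\*)⁻¹(1) =
liftEndY (onFun EE)`, `EE` = r03's kernel-checked [4] (2.35) `(QGQ\*)⁻¹` for `G = Δ_a⁻¹` (2.19)–(2.22) on the multi-level V1 model (`B6SectAVectorModelV1`);
def-Y's `aY = (diag w)♯` (`aK_eq_diagonal`); and def-Y's `Q(1)` of (125) is a scalar-coefficient form (the unfolding behind `KY_one`).  So the door's last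
`U = 1` row is a statement about ONE REAL SCALAR OPERATOR, `η^{d+1}(onFun EE − w)`, on REAL bond functions of print's constrained subspace — [4] (2.153)
exactly where [4] proves it, in the B6…V1 vocabulary the [4]-typing cells work in (`B6QGQCoerciveKLevelV1`, `B6Ineq2118TwoScaleV1`, `B6SectALemma24OneLevelV1`;
dag-n08-b CLAIM-16 (A) `B6Ineq2118LowerMultiLevelV1` (Schur + Jensen, multi-level (2.118)-lower) + (B) `B6Lemma24TopTorusV1` supply this scalar row).  This
file TYPES THAT REDUCTION — and types it for ANY description of the constrained subspace by a vanishing set of bonds `Z` and a set `S` of coarse bonds carrying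
the `Q(1)`-constraint, because WHICH subspace is print's is itself in flux: dag-n08-b's CHECK-L (bus 2026-08-29T01:23Z, witness in their `N08-CHECK-L-g36.md`)
shows that on def-Y's CURRENT subspace (`inΛY` = source block in `Λ`; constraints at `CBondY` = coarse bonds with BOTH end blocks in `Λ′`) `Δ_k(1)` has a
kernel at slab-shaped members (a coarse pure gauge across a good∕non-good face survives), so the row as displayed by p683587 is unsatisfiable there, while
under [4]'s STAR reading of «c ∈ Λ′» (p. 224, p. 245: «at least one of the end-points») it is print's (2.153) and follows from (A)+(B).  The reduction below is
indifferent to that repair (node00-def-Y's call): §3 states it for arbitrary `(Z, S)`, with the current-letters instance (the by-name junction to the EXISTING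
door rows) and the star instance (CHECK-L's binder) as one-line corollaries; the door EDITION modulo the scalar row is deliberately NOT filed until the
letters are repaired.

v1.1 (seat `dag-n08-d` gen 38, INTENT-95, 2026-08-29; §1–§3 byte-identical; one new light import, def-Y's `Node00.OpsYSectEStarGeometry` p689888, for §5's
names only) adds §4 THE STAR-CORNER BRIDGE and §5 its def-Y-NAMED form.  node00-def-Y's STAR EDITION
part 1 (INTENT-65, `Node00/OpsYSectEStarGeometry`: variables `inΛstY q :↔ lvl q = k ∧ (GoodY (usrc q) ∨ GoodY (utgt q))`, constraint index `IsCoarseStY c :↔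
IsCornerY c.1 ∧ (GoodY c.1 ∨ GoodY (unextY c.1 c.2))` — [4]'s «at least one of the end-points» on both the variables and the constraints) makes the
elimination `C` of the star letters solve the constraints `(Q(1)·)(c) = 0` at the STAR-COARSE corners only, while §3's `_star` rows (and dag-n08-b's
discharged `scalarRow_star` ∕ `ineq2153_one_star`, p687169 + `…PrecisionDoorGamma0AtOneStar`) take the constraint at EVERY block-corner bond.  §4 proves
the clause §3's docstring promised — for a field supported on the star set the constraint is AUTOMATIC at a corner bond whose two end blocks are both
non-good — from ONE geometric fact on def-Y's unit-torus chart, THE SEGMENT DICHOTOMY: the unit sites of the straight segments `[z, z + L e_μ]`,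
`z ∈ B(y)`, of `(Q(1)·)(y, μ)` lie in `B(y) ∪ B(y + L e_μ)` (torus seam included, read in `ZMod`).  So the two readings of the constraint index give the
SAME row on the star subspace, and the star door's transfer can call the all-corner rows with fields constrained only at `IsCoarseStY` corners (binders
spelled out in §4 — they are def-Y's `inΛstY ∕ IsCoarseStY` by `Iff.rfl` — and keyed to def-Y's names `inΛstY ∕ CBondStY` in §5).

WHAT IS PROVED (sorry-free, 0 `def`, standard axioms; pairing `trIP 1` = `Σ_q Re tr(Φ(q)ᴴΨ(q))` and real coordinates `cpart` of n06-h).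
* §1 private [folklore] `cpart_sum`, `cpart_ofReal_mul`, `cpart_zero'`; ★ `liftOpY_coer_on` — THE CONSTRAINED QUANTITATIVE LIFT: `γ·(g·g) ≤ g·(Mg)` for a real
  matrix `M` on every real `g` of a class `P` ⇒ `γ⟨Φ,Φ⟩₁ ≤ ⟨Φ, M♯Φ⟩₁` for every matrix field `Φ` whose `2N²` real coordinates `(Re∕Im) Φ(·)_{ab}` lie in `P`
  (n06-j's `B9DeltaAOneCoerciveOneLevelY.liftOpY_coer` = the case `P = ⊤`, same three-line proof over n06-h's `trIP_one_liftOpY_eq` and n06-j's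
  `trIP_one_self_eq`, both BY NAME).
* §2 at NODE 00, `U = 1` (def-Y ∕ n06 letters BY NAME, any member `x`): private `liftMatY_real_smul`; `aY_eq_liftOpY_diagonal` (`a = (diag w)♯`);
  ★ `deltaKPY_one_eq_liftOpY` — for covariance letters `𝔏` with `𝔏.QG1Qinv 1 = liftEndY T₀` (the `U = 1` clause shape) and any Sect. E letters `𝔢`:
  `deltaKPY x 𝔏 𝔢 1 = (η^{d+1}·([T₀] − diag w))♯`; private `deltaKMat_mulVec`; ★ `Q1Y_avYOfRecord_one_eq` — `Q(1)` OF (125) AT THE RECORD's AVERAGED FIELD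
  EXPLICITLY, any fibre: `Q1Y x (avYOfRecord x) 1 c B = L^{−(d+2)} • Σ_{z ∈ B(c₋)} Σ_{s<L} readUY x B [z + s e_μ, μ]` (the opening of def-Y's `KY_one` as a
  formula — the `U = 1` face a «`Q1Y … 1` ↔ one-step block average on `readUY`» dictionary keys); `readUY_coord`, `qNormY_eq_ofReal`;
  ★ `Q1Y_avYOfRecord_one_coord` — the `(a,b,Re∕Im)` coordinate of `(Q(1)B)(c)` IS `(Q(1)g)(c)` for the coordinate function `g = (Re∕Im)B(·)_{ab}` read at the
  fibre `ℂ`, ANY coarse bond `c` of the unit lattice; `Q1Y_avYOfRecord_one_coord_eq_zero` (the constraint `(Q(1)B)(c) = 0` passes to each coordinate).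
* §3 ★★ `ineq2153_one_of_scalarRow_on` — GENERIC: at ANY covariance letters with `𝔏.QG1Qinv 1 = liftEndY T₀`, any `𝔢`, any vanishing set `Z : IBondY → Prop`,
  any constraint set `S : USiteY × Fin (d+1) → Prop`: the SCALAR row «`g = 0` on `Z`, `(Q(1)g)(c) = 0` (`c ∈ S`) ⇒ `γ Σ_q g(q)² ≤ η^{d+1} Σ_q g(q)((T₀g)(q) −
  w(q)g(q))`» for all REAL `g` ⇒ the matrix row «`B = 0` on `Z`, `(Q(1)B)(c) = 0` (`c ∈ S`) ⇒ `γ·trIP 1 B B ≤ trIP 1 B (deltaKPY x 𝔏 𝔢 1 B)`» for all `B :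
  bonds → M_N(ℂ)`; ★ `ineq2153_one_of_scalarRow` — INSTANCE at def-Y's CURRENT subspace = p683587 §1–§3's binder VERBATIM (`¬ inΛY`, `IsAxialY`, `c : CBondY x`;
  CHECK-L caveat in the docstring); ★ `ineq2153_one_of_scalarRow_star` — INSTANCE at PRINT's STAR subspace in def-Y's interim spelling (WORD-L (5): variables = top-level bonds with
  `GoodY (usrc q) ∨ GoodY (utgt q)`, off the axial trees; constraints at EVERY block-corner bond); `lettersYOfRecordV4_QG1Qinv_one_eq_liftEndY` (at the v4 letters of record, any residual family: `T₀ =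
  onFun (EE (domT x.hN x.D x.hk) x.hcf x.hw)` — the `have` of p679063 ∕ n06-i's `B9Eq3132AtOneFacesAtLetters` as a citable lemma); ★★
  `ineq2153_one_lettersYOfRecordV4_of_scalarRow_on` ∕ `…_of_scalarRow` ∕ `…_of_scalarRow_star` — THE INSTANCES OF RECORD: the scalar [4] (2.153) for
  `η^{d+1}(onFun EE − w)` on NODE 00's carrier ⇒ the matrix Δ_k-row at `lettersYOfRecordV4 N θ M⋆ 𝔯 x`, any `𝔢` (so p683587 §2's v8 letters `resYOfC2 𝔠`,
  `sectEYOfRecordV6 … (sectEYWithDt2 …)` and §3's family form are covered), for the generic ∕ current ∕ star subspace respectively.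

* §4 (v1.1) THE STAR-CORNER BRIDGE (any member `x`; def-Y's chart `labK ∕ ofZ ∕ ublockY ∕ unextY ∕ IsCornerY ∕ GoodY` BY NAME): `ofZ_add_mem_ublockY_of_le`
  (block points by offsets `0 ≤ r ≤ L − 1`), `ofZ_labK_add_eq` (chart under translation), ★ `isCornerY_unextY` (`y + L e_μ` is an `L`-lattice point),
  ★★ `ofZ_labK_add_smul_mem_ublockY_or` — THE SEGMENT DICHOTOMY `z + t e_μ ∈ B(y) ∪ B(y + L e_μ)` (`z ∈ B(y)`, `0 ≤ t ≤ L`), `goodY_or_of_goodY_seg`,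
  `seg_tgt_eq`; ★ `readUY_seg_eq_zero_of_starSupport` (any fibre: star support ⇒ the unit-bond reading vanishes along the segments of a corner bond with
  both end blocks non-good); ★★ `Q1Y_avYOfRecord_one_eq_zero_of_starSupport` — `(Q(1)B)(c) = 0` IS AUTOMATIC at such corners; ★★
  `Q1Y_one_eq_zero_of_isCornerY_of_coarseSt` — constraints at the STAR-COARSE corners ⇒ constraints at EVERY corner (any fibre); ★
  `scalarRow_coarseSt_iff_star` — the two constraint readings give the same scalar row (any conclusion `P g`); ★★ `ineq2153_one_of_scalarRow_star_coarseSt`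
  (all-corner scalar row ⇒ matrix row for fields constrained at the star-coarse corners only — the star door's shape), `ineq2153_one_of_scalarRow_coarseSt`
  (both sides star-coarse; instance of §3 `_on`), and the letters-of-record forms `ineq2153_one_lettersYOfRecordV4_of_scalarRow_star_coarseSt` ∕
  `…_of_scalarRow_coarseSt`.
* §5 (v1.1) BY NAME at node00-def-Y's star edition part 1 (p689888): ★★ `Q1Y_one_eq_zero_of_isCornerY_of_CBondStY` (`B = 0` off `inΛstY`, constraints at
  `c : CBondStY x` ⇒ constraints at every corner), ★★ `ineq2153_one_of_scalarRow_star_st` ∕ `ineq2153_one_lettersYOfRecordV4_of_scalarRow_star_st` (the matrix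
  Δ_k-row for exactly the binders the star letters' `B := C(1)Φ` carries, from the all-corner scalar row dag-n08-b's `scalarRow_star` discharges).
HONEST SCOPE.  Count-neutral consumer-side algebra: compositions BY NAME of def-Y's `U = 1` letters (`deltaKPY_one`, `QG1QinvY_one`, `aK_eq_diagonal`,
`Q1Y_apply`, `hol_apply_of_id`, `trSum_usegY_of_id`, `avYOfRecord_one`, `readUY`), n06-i's `QGQinvY_one_liftEndY`, n06-h∕n06-j's trace-coordinate lemmas; no
new definition, no `def … : Prop`; every theorem is an implication «scalar row on (Z, S) ⇒ matrix row on (Z, S)», true for every `(Z, S)`; for `N ≥ 1` the two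
rows are equivalent (matrix ⇒ scalar by `B := g ⊗ 1`, not typed — only the direction the doors need is).  WHICH `(Z, S)` is print's subspace at NODE 00's
letters is node00-def-Y's repair after dag-n08-b's CHECK-L (current letters: unsatisfiable row at slab members; star reading: print's); this file does not
decide it and does not file a door edition on either.  `γ₀` ∕ (2.153) ∕ G-B9-09 is NOT proved and NOT claimed: what (2.153) IS — (2.118) (the Jensen half
`∂₁Q_k = M_k∂` with the Schur minimum `⟨B,((QGQ\*)⁻¹ − a)B⟩ = inf_{QA = B}(‖∂A‖² + ‖R∂\*A‖²)`) for the multi-level `EE` and Lemma 2.4 (2.128) on NODE 00's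
unit lattice — is node N06 ∕ cell `pub-balaban` ∕ dag-n08-b CLAIM-16 content (tree today: `B6Ineq2118TwoScaleV1` two-scale, `B6LowerBound2153Torus` ∕
`B6Lemma24Torus` on `Tor M`, `B6SectALemma24OneLevelV1`, `Node00.Carriers3.lemma24_treeOfRecord`; the k-level statement on `domT` not landed at filing).
Nothing at `U ≠ 1` (p. 428: «localizing the operators in Δ_k and using the methods of Sect. B»); the IDENT for row `h324c` is NOT made, NOT commissioned, NOT
claimed; nothing of [Balaban1985UV3], [Balaban1985BackgroundPropagators], [Balaban1984PropagatorsII], [Balaban1985Averaging], [Balaban1982Higgs1] or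
[BenfattoEtAl1978] is asserted beyond what the tree proves; node N08 is NOT discharged; nothing about d = 4, the continuum, OS axioms, a mass gap or the Clay
problem.
(v1.1) §4–§5 are finite geometry ∕ bookkeeping on node00-def-Y's unit-torus chart (no estimate, no letter, nothing of the sources asserted): it
identify the two readings of the constraint index on the star subspace and file no door; `γ₀` remains dag-n08-b's theorem, not this file's.
-/



noncomputable section

open Finset Matrix
open scoped Matrix.Norms.L2Operator

namespace Literature.MathematicalPhysics.QuantumFieldTheory.Balaban1983to89.B1Eq324BenfattoClassSectEMemberIneq2153ScalarReductionAtNode00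

open Literature.MathematicalPhysics.QuantumFieldTheory
open Literature.MathematicalPhysics.QuantumFieldTheory.Balaban1983to89.B9Thm311ReadingCoords (trIP cpart cpart_zero cpart_one cpart_add
  cpart_smul sum_cpart_mul_cpart)
open Literature.MathematicalPhysics.QuantumFieldTheory.Balaban1983to89.Node00

/-! ## §1 [folklore] The CONSTRAINED quantitative lift: a lower bound for a real matrix on a CLASS of real scalar functions passes to the weight-one
trace pairing on matrix fields whose real coordinates lie in the class (n06-j's `liftOpY_coer` with a predicate; n06-h's entrywise reading
`trIP_one_liftOpY_eq` and n06-j's `trIP_one_self_eq` BY NAME) -/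

section Fibre

variable {N : ℕ} {X : Type} [Fintype X]

/-- the real coordinates commute with finite sums. [folklore] -/
private theorem cpart_sum {ι : Type} (s : Finset ι) (c : Fin 2) (f : ι → ℂ) : cpart c (∑ i ∈ s, f i) = ∑ i ∈ s, cpart c (f i) := by
  fin_cases c
  · simp [Complex.re_sum]
  · simp [Complex.im_sum]

/-- the real coordinates commute with multiplication by a real scalar. [folklore] -/
private theorem cpart_ofReal_mul (c : Fin 2) (r : ℝ) (z : ℂ) : cpart c ((r : ℂ) * z) = r * cpart c z := by
  fin_cases c
  · simp [Complex.mul_re]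
  · simp [Complex.mul_im]

/-- both real coordinates of `0` vanish. [folklore] -/
@[simp] private theorem cpart_zero' (c : Fin 2) : cpart c (0 : ℂ) = 0 := by
  fin_cases c <;> simp

/-- ★ **THE CONSTRAINED QUANTITATIVE LIFT** [folklore]: a lower bound `γ·(g·g) ≤ g·(Mg)` for a REAL matrix `M` on every real scalar function `g` of a class
`P` gives `γ⟨Φ, Φ⟩₁ ≤ ⟨Φ, M♯Φ⟩₁` in the weight-one trace pairing for every matrix field `Φ` all of whose `2N²` real coordinate functions `(Re∕Im) Φ(·)_{ab}`
lie in `P` — n06-j's `B9DeltaAOneCoerciveOneLevelY.liftOpY_coer` (the case `P = ⊤`) with a predicate, same proof over n06-h's entrywise reading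
`trIP_one_liftOpY_eq` and `trIP_one_self_eq`.  This is the componentwise step of [4] (2.153) («‖B‖²» for 𝔤-valued `B`; the bound is proved for, and summed
over, the real components). [cite: Balaban1984PropagatorsII, (2.153) p.249, (2.14) p.225; folklore] -/
theorem liftOpY_coer_on [DecidableEq X] (M : Matrix X X ℝ) {γ : ℝ} (P : (X → ℝ) → Prop)
    (hM : ∀ g : X → ℝ, P g → γ * (g ⬝ᵥ g) ≤ g ⬝ᵥ M *ᵥ g)
    (Φ : X → Matrix (Fin N) (Fin N) ℂ) (hΦ : ∀ (a b : Fin N) (c : Fin 2), P fun z => cpart c (Φ z a b)) :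
    γ * trIP (fun _ => (1 : ℝ)) Φ Φ ≤ trIP (fun _ => (1 : ℝ)) Φ (liftOpY (Matrix (Fin N) (Fin N) ℂ) M Φ) := by
  rw [B9Thm311InputsAtOne.trIP_one_liftOpY_eq, B9DeltaAOneCoerciveOneLevelY.trIP_one_self_eq, Finset.mul_sum]
  refine Finset.sum_le_sum fun a _ => ?_
  rw [Finset.mul_sum]
  refine Finset.sum_le_sum fun b _ => ?_
  rw [Finset.mul_sum]
  exact Finset.sum_le_sum fun c _ => hM _ (hΦ a b c)

end Fibre

/-! ## §2 At NODE 00's letters, `U = 1`: print's `η^{d+1}Δ_k(1) = η^{d+1}(QG₁Q*)⁻¹(1) − η^{d+1}a` IS the lift of a real matrix, and `Q(1)` of (125)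
reads every real coordinate of a matrix field through the same scalar formula -/

section AtOne

open B9PinMembersKLevelV1 (MemberY)
open B9PinGeometryKLevelV1 (inΛY)
open B6BondElimination (unitVec)

variable {N : ℕ} {d ℓ : ℕ} {hd : 1 ≤ d + 1} {hL : Odd (ℓ + 1) ∧ 1 < ℓ + 1} {b₀ b₁ : ℝ} {Mstar : ℕ}

/-- the lift of a real multiple of a real matrix is the (real) multiple of the lift. [folklore] -/
private theorem liftMatY_real_smul {𝔸 : Type} [NormedRing 𝔸] [NormedAlgebra ℂ 𝔸] {X Y : Type} [Fintype X] (r : ℝ) (M : Matrix Y X ℝ) :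
    liftMatY 𝔸 (r • M) = ((r : ℝ) : ℂ) • liftMatY 𝔸 M := by
  apply LinearMap.ext
  intro Λ
  funext y
  rw [LinearMap.smul_apply, Pi.smul_apply, liftMatY_apply, liftMatY_apply, Finset.smul_sum]
  refine Finset.sum_congr rfl fun z _ => ?_
  rw [Matrix.smul_apply, smul_eq_mul, Complex.ofReal_mul, mul_smul]

variable (x : MemberY d ℓ hd hL b₀ b₁ Mstar)

/-- the weight letter `a` of NODE 00 is the lift of the real diagonal matrix `diag(w)` (def-Y `aY = (aK)♯`, `aK = diag w`).
[cite: Balaban1985BackgroundPropagators, (3.25)–(3.26) p.395, bookkeeping] -/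
theorem aY_eq_liftOpY_diagonal {𝔸 : Type} [NormedRing 𝔸] [NormedAlgebra ℂ 𝔸] [CompleteSpace 𝔸] :
    aY (𝔸 := 𝔸) x.toKIdx = liftOpY 𝔸 (Matrix.diagonal x.toKIdx.w) := by
  show liftMatY 𝔸 (aK x.toKIdx) = _
  rw [aK_eq_diagonal, liftOpY_eq_liftMatY]

/-- ★ **`η^{d+1}Δ_k(1)` IS THE LIFT OF A REAL MATRIX**: at any covariance letters `𝔏` whose `(QG₁Q*)⁻¹(1)` is the lift of a real endomorphism `T₀` of the
bond functions (the `U = 1` clause shape of the letter — at the letters of record `T₀` = [4]'s `(QGQ*)⁻¹` of (2.35), §3) and any Sect. E letters `𝔢`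
(`D2J(1) = 0`), def-Y's print-unit `deltaKPY … 1 = η^{d+1}(QG₁Q*)⁻¹(1) − η^{d+1}a` (`deltaKPY_one`) is `(η^{d+1}·([T₀] − diag w))♯`.
[cite: Balaban1985BackgroundPropagators, (3.156) p.428, Cor. 3.5 p.407 («for U = 1 … [4]»); Balaban1984PropagatorsII, (2.35) p.228] -/
theorem deltaKPY_one_eq_liftOpY (𝔏 : CovLettersY (Matrix (Fin N) (Fin N) ℂ) x) (𝔢 : SectELettersY (Matrix (Fin N) (Fin N) ℂ) x)
    (T₀ : Module.End ℝ (IBondY x.toKIdx → ℝ)) (hT : 𝔏.QG1Qinv (fun _ _ => 1) = liftEndY (Matrix (Fin N) (Fin N) ℂ) T₀) :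
    deltaKPY x 𝔏 𝔢 (fun _ _ => 1) =
      liftOpY (Matrix (Fin N) (Fin N) ℂ) (etaDY x • (LinearMap.toMatrix' T₀ - Matrix.diagonal x.toKIdx.w)) := by
  rw [deltaKPY_one, hT, liftEndY_eq_liftMatY, aY_eq_liftOpY_diagonal, liftOpY_eq_liftMatY, liftOpY_eq_liftMatY, liftMatY_real_smul,
    liftMatY_sub, smul_sub]

/-- the real matrix of the lift applied to a real bond function: `(η^{d+1}([T₀] − diag w))·g = η^{d+1}(T₀ g − w·g)`. [folklore] -/
private theorem deltaKMat_mulVec (T₀ : Module.End ℝ (IBondY x.toKIdx → ℝ)) (g : IBondY x.toKIdx → ℝ) (q : IBondY x.toKIdx) :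
    ((etaDY x • (LinearMap.toMatrix' T₀ - Matrix.diagonal x.toKIdx.w)) *ᵥ g) q = etaDY x * (T₀ g q - x.toKIdx.w q * g q) := by
  rw [Matrix.smul_mulVec, Pi.smul_apply, Matrix.sub_mulVec, Pi.sub_apply, LinearMap.toMatrix'_mulVec, Matrix.mulVec_diagonal,
    smul_eq_mul]

/-- ★ **`Q(1)` OF (125) AT THE RECORD's AVERAGED FIELD, EXPLICITLY** (any fibre `𝔸`): with identity transports, `(Q(1)B)(c) = L^{−(d+2)} Σ_{z ∈ B(c₋)}
Σ_{s<L} B̃([z + s e_μ, z + (s+1) e_μ])` — the plain double sum of the unit-bond reading of `B` over the block and the segment (the opening of def-Y's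
`KY_one`, as a standalone formula). [cite: Balaban1985Averaging, (125) p.36 (V = 1); Balaban1984PropagatorsII, (2.125) p.245; Balaban1984PropagatorsI, (1.18) p.20] -/
theorem Q1Y_avYOfRecord_one_eq {𝔸 : Type} [NormedRing 𝔸] [NormedAlgebra ℂ 𝔸] [CompleteSpace 𝔸] (c : USiteY x × Fin (d + 1))
    (B : IBondY x.toKIdx → 𝔸) :
    Q1Y x (avYOfRecord x) (fun _ _ => 1 : CfgY 𝔸 x.toKIdx) c B =
      qNormY d ℓ • ∑ z ∈ ublockY x c.1, ∑ s ∈ Finset.range (ℓ + 1), readUY x B ⟨ofZ x (labK x z + (s : ℤ) • unitVec c.2), c.2⟩ := by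
  have hT : ∀ (b : UBondY x) (v : 𝔸), RUY x (avYOfRecord x) (fun _ _ => 1 : CfgY 𝔸 x.toKIdx) b v = v := fun b v => by
    rw [RUY_apply, avYOfRecord_one, B9Eq39Adjoint.R_one]
  rw [Q1Y_apply]
  simp only [hol_apply_of_id _ (RVY_avYOfRecord_one x), trSum_usegY_of_id x _ hT]

/-- the unit-bond reading, entry by entry and coordinate by coordinate: reading the real coordinate function `q ↦ (Re∕Im) B(q)_{ab}` (cast to `ℂ`) gives
the coordinate of the entry of the reading of `B`. [cite: Balaban1984PropagatorsII, (2.3) p.224, bookkeeping] -/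
theorem readUY_coord (B : IBondY x.toKIdx → Matrix (Fin N) (Fin N) ℂ) (a b : Fin N) (cc : Fin 2) (bd : UBondY x) :
    readUY x (fun q => ((cpart cc (B q a b) : ℝ) : ℂ)) bd = ((cpart cc (readUY x B bd a b) : ℝ) : ℂ) := by
  by_cases h : bd.src ∈ (B6GlobalChartV1.domT x.hN x.D x.hk).Om x.k
  · rw [readUY_apply_of_mem x _ h, readUY_apply_of_mem x _ h]
  · rw [readUY_apply_of_not_mem x _ h, readUY_apply_of_not_mem x _ h, Matrix.zero_apply, cpart_zero', Complex.ofReal_zero]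

/-- the normalisation `L^{−(d+2)}` of (125) is real. [cite: Balaban1985Averaging, (125) p.36, bookkeeping] -/
theorem qNormY_eq_ofReal : qNormY d ℓ = ((((((ℓ + 1 : ℕ) : ℝ)) ^ (d + 2))⁻¹ : ℝ) : ℂ) := by
  rw [qNormY]; push_cast; rfl

/-- ★ **`Q(1)` READS EVERY REAL COORDINATE THROUGH THE SAME SCALAR FORMULA**: the `(a, b, Re∕Im)` coordinate of `(Q(1)B)(c)` for a matrix field `B` is
`(Q(1)g)(c)` for the real coordinate function `g(q) = (Re∕Im) B(q)_{ab}` read at the fibre `ℂ` (same record, same `U = 1`) — so the constraint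
`Q₁B = 0` of (3.156) passes to each coordinate. [cite: Balaban1985BackgroundPropagators, (3.156) p.428; Balaban1985Averaging, (125) p.36; Balaban1984PropagatorsII, (2.153) p.249 (𝔤-valued B, componentwise)] -/
theorem Q1Y_avYOfRecord_one_coord (c : USiteY x × Fin (d + 1)) (B : IBondY x.toKIdx → Matrix (Fin N) (Fin N) ℂ) (a b : Fin N) (cc : Fin 2) :
    Q1Y x (avYOfRecord x) (fun _ _ => 1 : CfgY ℂ x.toKIdx) c (fun q => ((cpart cc (B q a b) : ℝ) : ℂ)) =
      ((cpart cc (Q1Y x (avYOfRecord x) (fun _ _ => 1 : CfgY (Matrix (Fin N) (Fin N) ℂ) x.toKIdx) c B a b) : ℝ) : ℂ) := by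
  rw [Q1Y_avYOfRecord_one_eq, Q1Y_avYOfRecord_one_eq]
  simp only [readUY_coord, Matrix.smul_apply, Matrix.sum_apply, smul_eq_mul, qNormY_eq_ofReal, cpart_ofReal_mul, cpart_sum]
  push_cast
  rfl

/-- hence: `(Q(1)B)(c) = 0` for the matrix field ⇒ `(Q(1)g)(c) = 0` for each of its real coordinate functions.
[cite: Balaban1985BackgroundPropagators, (3.156) p.428; Balaban1984PropagatorsII, (2.153) p.249] -/
theorem Q1Y_avYOfRecord_one_coord_eq_zero (c : USiteY x × Fin (d + 1)) (B : IBondY x.toKIdx → Matrix (Fin N) (Fin N) ℂ)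
    (hB : Q1Y x (avYOfRecord x) (fun _ _ => 1 : CfgY (Matrix (Fin N) (Fin N) ℂ) x.toKIdx) c B = 0) (a b : Fin N) (cc : Fin 2) :
    Q1Y x (avYOfRecord x) (fun _ _ => 1 : CfgY ℂ x.toKIdx) c (fun q => ((cpart cc (B q a b) : ℝ) : ℂ)) = 0 := by
  rw [Q1Y_avYOfRecord_one_coord, hB, Matrix.zero_apply, cpart_zero', Complex.ofReal_zero]

end AtOne

/-! ## §3 ★★ The Δ_k-row for matrix fields (trace pairing) FROM ONE SCALAR ROW (real bond functions) — for ANY description of the constrained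
subspace by a vanishing set of bonds `Z` and a set `S` of coarse bonds carrying the `Q(1)`-constraint -/

section Reduction

open B9PinMembersKLevelV1 (MemberY)
open B9PinGeometryKLevelV1 (inΛY)
open B6SectAVectorModelV1 (EE)
open B6GlobalChartV1 (domT)
open B6Ineq2133TwoScaleV1 (onFun)
open B9Eq3132SectDLetters (QGQinvY_one_liftEndY)
open B6Ineq2142KLevelV1 (lvl)

variable {N : ℕ} {d ℓ : ℕ} {hd : 1 ≤ d + 1} {hL : Odd (ℓ + 1) ∧ 1 < ℓ + 1} {b₀ b₁ : ℝ} {Mstar : ℕ}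
variable (x : MemberY d ℓ hd hL b₀ b₁ Mstar)

/-- ★★ **THE MATRIX Δ_k-ROW FROM THE SCALAR Δ_k-ROW, FOR ANY CONSTRAINED SUBSPACE OF PRINT's SHAPE.**  At a member `x`, covariance letters `𝔏` whose
`(QG₁Q*)⁻¹(1)` is the lift of a real endomorphism `T₀` of the bond functions, any Sect. E letters `𝔢`, ANY set `Z` of bonds on which the fields vanish
(print: `B = 0` on `Λᶜ` and on the axial trees `⋃ Ax(y)`) and ANY set `S` of coarse bonds `c = (y, μ)` of the unit lattice carrying the constraint
`(Q(1)·)(c) = 0` (print: `c ∈ Λ′`; WHICH reading of «`c ∈ Λ′`» — both end blocks in `Λ′` as def-Y's `CBondY`, or [4] p. 224 ∕ p. 245 «at least one of the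
end-points belongs to Λ» — is a parameter here, see the two instances below and dag-n08-b's CHECK-L): IF the scalar operator `η^{d+1}(T₀ − w)` satisfies the
(2.153)-shaped bound `γ Σ_q g(q)² ≤ η^{d+1} Σ_q g(q)((T₀g)(q) − w(q)g(q))` for every REAL bond function `g` vanishing on `Z` with `(Q(1)g)(c) = 0` for `c ∈ S`
(def-Y's `Q1Y` of (125) at the record's averaged field, fibre `ℂ`), THEN `γ⟨B,B⟩₁ ≤ ⟨B, η^{d+1}Δ_k(1)B⟩₁` (trace pairing `trIP 1`, def-Y's `deltaKPY … 1`) for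
every `B : bonds → M_N(ℂ)` vanishing on `Z` with `(Q(1)B)(c) = 0` for `c ∈ S`.  Proof: `η^{d+1}Δ_k(1) = (η^{d+1}([T₀] − diag w))♯` (§2 `deltaKPY_one_eq_liftOpY`),
the constrained lift §1 `liftOpY_coer_on` over the `2N²` real coordinates `(Re∕Im) B(·)_{ab}`, each of which vanishes on `Z` and satisfies the scalar
constraints (§2 `Q1Y_avYOfRecord_one_coord_eq_zero`).  Print: [4] (2.153) is stated for `𝔤`-valued `B` with `‖B‖² = Σ_b |B(b)|²` and proved component by
component; this is that step at NODE 00's letters. [cite: Balaban1984PropagatorsII, (2.153) p.249, (2.14) p.225, (2.3) p.224; Balaban1985BackgroundPropagators, (3.156) p.428, Cor. 3.5 p.407] -/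
theorem ineq2153_one_of_scalarRow_on (𝔏 : CovLettersY (Matrix (Fin N) (Fin N) ℂ) x) (𝔢 : SectELettersY (Matrix (Fin N) (Fin N) ℂ) x)
    (T₀ : Module.End ℝ (IBondY x.toKIdx → ℝ)) (hT : 𝔏.QG1Qinv (fun _ _ => 1) = liftEndY (Matrix (Fin N) (Fin N) ℂ) T₀)
    (Z : IBondY x.toKIdx → Prop) (S : USiteY x × Fin (d + 1) → Prop) {γ : ℝ}
    (hrow : ∀ g : IBondY x.toKIdx → ℝ, (∀ q, Z q → g q = 0) →
      (∀ c, S c → Q1Y x (avYOfRecord x) (fun _ _ => 1 : CfgY ℂ x.toKIdx) c (fun q => ((g q : ℝ) : ℂ)) = 0) →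
        γ * ∑ q, g q ^ 2 ≤ etaDY x * ∑ q, g q * (T₀ g q - x.toKIdx.w q * g q))
    (B : IBondY x.toKIdx → Matrix (Fin N) (Fin N) ℂ) (hZ : ∀ q, Z q → B q = 0)
    (hS : ∀ c, S c → Q1Y x (avYOfRecord x) (fun _ _ => 1 : CfgY (Matrix (Fin N) (Fin N) ℂ) x.toKIdx) c B = 0) :
    γ * trIP (fun _ => (1 : ℝ)) B B ≤ trIP (fun _ => (1 : ℝ)) B (deltaKPY x 𝔏 𝔢 (fun _ _ => 1) B) := by
  classical
  rw [deltaKPY_one_eq_liftOpY x 𝔏 𝔢 T₀ hT]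
  refine liftOpY_coer_on _
    (fun g => (∀ q, Z q → g q = 0) ∧ ∀ c, S c → Q1Y x (avYOfRecord x) (fun _ _ => 1 : CfgY ℂ x.toKIdx) c (fun q => ((g q : ℝ) : ℂ)) = 0) ?_ B ?_
  · rintro g ⟨h1, h2⟩
    calc γ * (g ⬝ᵥ g) = γ * ∑ q, g q ^ 2 := by rw [dotProduct]; simp only [sq]
      _ ≤ etaDY x * ∑ q, g q * (T₀ g q - x.toKIdx.w q * g q) := hrow g h1 h2
      _ = g ⬝ᵥ (etaDY x • (LinearMap.toMatrix' T₀ - Matrix.diagonal x.toKIdx.w)) *ᵥ g := by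
          rw [dotProduct, Finset.mul_sum]
          exact Finset.sum_congr rfl fun q _ => by rw [deltaKMat_mulVec]; ring
  · intro a b cc
    exact ⟨fun q hq => by show cpart cc (B q a b) = 0; rw [hZ q hq, Matrix.zero_apply, cpart_zero'],
      fun c hc => Q1Y_avYOfRecord_one_coord_eq_zero x c B (hS c hc) a b cc⟩

/-- ★ **INSTANCE: def-Y's CURRENT constrained subspace** — the binder of n08-b's p683587 §1–§3 VERBATIM (`B = 0` off `Λ` by `inΛY` = source block in `Λ`,
`B = 0` on the axial bonds `IsAxialY`, `(Q(1)B)(c) = 0` for `c : CBondY x` = BOTH end blocks of `c` in `Λ′`): the scalar row on that subspace ⇒ the matrix row on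
that subspace.  HONEST (dag-n08-b CHECK-L, bus 2026-08-29T01:23Z, witness kept in their `N08-CHECK-L-g36.md`): on THIS subspace `Δ_k(1)` has a kernel at
slab-shaped members (a coarse pure gauge across a good∕non-good face survives the both-good constraints), so the scalar row displayed here is UNSATISFIABLE
with `γ > 0` at such members and the implication is then vacuous — [4] reads «`c ∈ Λ′`» ∕ «`B = 0` on `Λᶜ`» with the STAR convention (p. 224 (2.3), p. 245:
«at least one of the end-points … belongs to Λ»), under which (2.153) holds; the repair of the letters (`inΛY`, `IsCoarseY`, pivots, `Λ̃ ∕ C ∕ C*`) is node00-def-Y's.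
Kept because it is the by-name junction to the EXISTING door rows; the generic `ineq2153_one_of_scalarRow_on` serves the repaired subspace verbatim.
[cite: Balaban1984PropagatorsII, (2.153) p.249, (2.3) p.224; Balaban1985BackgroundPropagators, (3.156) p.428] -/
theorem ineq2153_one_of_scalarRow (𝔏 : CovLettersY (Matrix (Fin N) (Fin N) ℂ) x) (𝔢 : SectELettersY (Matrix (Fin N) (Fin N) ℂ) x)
    (T₀ : Module.End ℝ (IBondY x.toKIdx → ℝ)) (hT : 𝔏.QG1Qinv (fun _ _ => 1) = liftEndY (Matrix (Fin N) (Fin N) ℂ) T₀) {γ : ℝ}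
    (hrow : ∀ g : IBondY x.toKIdx → ℝ, (∀ q, ¬ inΛY x q → g q = 0) → (∀ q, IsAxialY x q → g q = 0) →
      (∀ c : CBondY x, Q1Y x (avYOfRecord x) (fun _ _ => 1 : CfgY ℂ x.toKIdx) c.1 (fun q => ((g q : ℝ) : ℂ)) = 0) →
        γ * ∑ q, g q ^ 2 ≤ etaDY x * ∑ q, g q * (T₀ g q - x.toKIdx.w q * g q))
    (B : IBondY x.toKIdx → Matrix (Fin N) (Fin N) ℂ) (hΛ : ∀ q, ¬ inΛY x q → B q = 0) (hAx : ∀ q, IsAxialY x q → B q = 0)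
    (hQ : ∀ c : CBondY x, Q1Y x (avYOfRecord x) (fun _ _ => 1 : CfgY (Matrix (Fin N) (Fin N) ℂ) x.toKIdx) c.1 B = 0) :
    γ * trIP (fun _ => (1 : ℝ)) B B ≤ trIP (fun _ => (1 : ℝ)) B (deltaKPY x 𝔏 𝔢 (fun _ _ => 1) B) :=
  ineq2153_one_of_scalarRow_on x 𝔏 𝔢 T₀ hT (fun q => ¬ inΛY x q ∨ IsAxialY x q) (fun c => c ∈ coarseY x)
    (fun g hZ hS => hrow g (fun q hq => hZ q (Or.inl hq)) (fun q hq => hZ q (Or.inr hq)) fun c => hS c.1 c.2)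
    B (fun q hq => hq.elim (hΛ q) (hAx q)) fun c hc => hQ ⟨c, hc⟩

/-- ★ **INSTANCE: PRINT's STAR subspace, in node00-def-Y's INTERIM spelling** (def-Y WORD-L (5) on dag-n08-b's CHECK-L, bus 2026-08-29T01:27Z; the named
star letters `inΛstY ∕ IsCoarseStY` of def-Y's side-by-side STAR EDITION (a′) will re-key these binders by `Iff`-level lemmas): VARIABLES = the top-level bonds with
AT LEAST ONE end block good ([4] (2.3) p. 224 «at least one end-point of b belongs to Ω»: `g = 0` unless `lvl q = k ∧ (GoodY (usrc q) ∨ GoodY (utgt q))`) and off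
the axial trees; CONSTRAINTS = `(Q(1)g)(c) = 0` at EVERY block-corner bond `c = (y, μ)` of the unit lattice ([4] p. 245 «at least one of the end-points b₋, b₊
belongs to Λ»; the corners with both end blocks non-good are automatic).  The scalar row on that subspace ⇒ the matrix row on that subspace — the shape
dag-n08-b CLAIM-16 (A)+(B) supplies the scalar row in.  (An instance of `ineq2153_one_of_scalarRow_on`; which `(Z, S)` the repaired Sect. E letters finally carry is
node00-def-Y's.) [cite: Balaban1984PropagatorsII, (2.153) p.249, (2.3) p.224, Lemma 2.4 p.245; Balaban1985BackgroundPropagators, (3.156) p.428] -/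
theorem ineq2153_one_of_scalarRow_star (𝔏 : CovLettersY (Matrix (Fin N) (Fin N) ℂ) x) (𝔢 : SectELettersY (Matrix (Fin N) (Fin N) ℂ) x)
    (T₀ : Module.End ℝ (IBondY x.toKIdx → ℝ)) (hT : 𝔏.QG1Qinv (fun _ _ => 1) = liftEndY (Matrix (Fin N) (Fin N) ℂ) T₀) {γ : ℝ}
    (hrow : ∀ g : IBondY x.toKIdx → ℝ,
      (∀ q, ¬ (lvl x.hN x.D x.hk q = x.k ∧ (GoodY x (usrc x q) ∨ GoodY x (utgt x q))) → g q = 0) → (∀ q, IsAxialY x q → g q = 0) →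
      (∀ c : USiteY x × Fin (d + 1), IsCornerY x c.1 → Q1Y x (avYOfRecord x) (fun _ _ => 1 : CfgY ℂ x.toKIdx) c (fun q => ((g q : ℝ) : ℂ)) = 0) →
        γ * ∑ q, g q ^ 2 ≤ etaDY x * ∑ q, g q * (T₀ g q - x.toKIdx.w q * g q))
    (B : IBondY x.toKIdx → Matrix (Fin N) (Fin N) ℂ)
    (hΛ : ∀ q, ¬ (lvl x.hN x.D x.hk q = x.k ∧ (GoodY x (usrc x q) ∨ GoodY x (utgt x q))) → B q = 0) (hAx : ∀ q, IsAxialY x q → B q = 0)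
    (hQ : ∀ c : USiteY x × Fin (d + 1), IsCornerY x c.1 → Q1Y x (avYOfRecord x) (fun _ _ => 1 : CfgY (Matrix (Fin N) (Fin N) ℂ) x.toKIdx) c B = 0) :
    γ * trIP (fun _ => (1 : ℝ)) B B ≤ trIP (fun _ => (1 : ℝ)) B (deltaKPY x 𝔏 𝔢 (fun _ _ => 1) B) :=
  ineq2153_one_of_scalarRow_on x 𝔏 𝔢 T₀ hT
    (fun q => ¬ (lvl x.hN x.D x.hk q = x.k ∧ (GoodY x (usrc x q) ∨ GoodY x (utgt x q))) ∨ IsAxialY x q) (fun c => IsCornerY x c.1)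
    (fun g hZ hS => hrow g (fun q hq => hZ q (Or.inl hq)) (fun q hq => hZ q (Or.inr hq)) hS)
    B (fun q hq => hq.elim (hΛ q) (hAx q)) hQ

variable (N) (θ : Stage3Params) (Mstar' : ℕ) (𝔯 : ResY N θ Mstar')

/-- at the v4 letters of record (any residual family `𝔯`): `(QG₁Q*)⁻¹(1)` IS the lift of [4]'s `(QGQ*)⁻¹` of (2.35) — r03's `EE` on NODE 00's own carrier
`BondIdx (domT …)` (def-Y `lettersYOfRecordV4_sectDE` + `QG1QinvY_one` + n06-i `QGQinvY_one_liftEndY`, by name; the `have` of n08-b's p679063 ∕ n06-i's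
`B9Eq3132AtOneFacesAtLetters`, as a citable lemma). [cite: Balaban1985BackgroundPropagators, (3.132) p.422, Cor. 3.5 p.407; Balaban1984PropagatorsII, (2.35) p.228] -/
theorem lettersYOfRecordV4_QG1Qinv_one_eq_liftEndY (x : MemberY θ.d₆ θ.ℓ₆ θ.hd' θ.hL' θ.b₀ θ.b₁ Mstar') :
    (lettersYOfRecordV4 N θ Mstar' 𝔯 x).QG1Qinv (fun _ _ => 1) =
      liftEndY (Matrix (Fin N) (Fin N) ℂ) (onFun (EE (domT x.hN x.D x.hk) x.hcf x.hw)) := by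
  have h0 : (lettersYOfRecordV4 N θ Mstar' 𝔯 x).QGQinv (fun _ _ => 1) =
      liftEndY (Matrix (Fin N) (Fin N) ℂ) (onFun (EE (domT x.hN x.D x.hk) x.hcf x.hw)) :=
    QGQinvY_one_liftEndY x.toKIdx (lettersYOfRecordV4 N θ Mstar' 𝔯 x).parS_one (lettersYOfRecordV4 N θ Mstar' 𝔯 x).parB_one
      (lettersYOfRecordV4 N θ Mstar' 𝔯 x).Gp_one
  rw [← h0]
  exact QG1QinvY_one x.toKIdx _ _ _ ((𝔯 x).Δ2_one)

/-- ★★ **AT THE LETTERS OF RECORD, ANY CONSTRAINED SUBSPACE**: the (2.153)-shaped scalar row for `η^{d+1}(E − w)`, `E = onFun (EE (domT …) …)` = r03's [4]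
(2.35) `(QGQ*)⁻¹` read on NODE 00's bond functions, `w` = the weights of `a`, on the real bond functions vanishing on `Z` with `(Q(1)g)(c) = 0` for `c ∈ S` ⇒
the matrix Δ_k-row at `lettersYOfRecordV4 N θ M⋆ 𝔯 x` (any residual family, e.g. `resYOfC2 𝔠`), any Sect. E letters `𝔢` (e.g. the v6 ∕ `WithDt2` records
the doors read), on the same subspace.  So at `U = 1` the Δ_k-row of any (3.24) door is a statement about [4]'s own scalar operator on `BondIdx (domT …)`.
[cite: Balaban1984PropagatorsII, (2.153) p.249, (2.35) p.228; Balaban1985BackgroundPropagators, (3.156) p.428, Cor. 3.5 p.407] -/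
theorem ineq2153_one_lettersYOfRecordV4_of_scalarRow_on (x : MemberY θ.d₆ θ.ℓ₆ θ.hd' θ.hL' θ.b₀ θ.b₁ Mstar')
    (𝔢 : SectELettersY (Matrix (Fin N) (Fin N) ℂ) x) (Z : IBondY x.toKIdx → Prop) (S : USiteY x × Fin (θ.d₆ + 1) → Prop) {γ : ℝ}
    (hrow : ∀ g : IBondY x.toKIdx → ℝ, (∀ q, Z q → g q = 0) →
      (∀ c, S c → Q1Y x (avYOfRecord x) (fun _ _ => 1 : CfgY ℂ x.toKIdx) c (fun q => ((g q : ℝ) : ℂ)) = 0) →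
        γ * ∑ q, g q ^ 2 ≤ etaDY x * ∑ q, g q * (onFun (EE (domT x.hN x.D x.hk) x.hcf x.hw) g q - x.toKIdx.w q * g q))
    (B : IBondY x.toKIdx → Matrix (Fin N) (Fin N) ℂ) (hZ : ∀ q, Z q → B q = 0)
    (hS : ∀ c, S c → Q1Y x (avYOfRecord x) (fun _ _ => 1 : CfgY (Matrix (Fin N) (Fin N) ℂ) x.toKIdx) c B = 0) :
    γ * trIP (fun _ => (1 : ℝ)) B B ≤ trIP (fun _ => (1 : ℝ)) B (deltaKPY x (lettersYOfRecordV4 N θ Mstar' 𝔯 x) 𝔢 (fun _ _ => 1) B) :=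
  ineq2153_one_of_scalarRow_on x (lettersYOfRecordV4 N θ Mstar' 𝔯 x) 𝔢 _ (lettersYOfRecordV4_QG1Qinv_one_eq_liftEndY N θ Mstar' 𝔯 x) Z S hrow B hZ hS

/-- ★★ **AT THE LETTERS OF RECORD, def-Y's CURRENT subspace** (p683587 §2's binder VERBATIM; CHECK-L caveat as in `ineq2153_one_of_scalarRow`).
[cite: Balaban1984PropagatorsII, (2.153) p.249, (2.35) p.228; Balaban1985BackgroundPropagators, (3.156) p.428] -/
theorem ineq2153_one_lettersYOfRecordV4_of_scalarRow (x : MemberY θ.d₆ θ.ℓ₆ θ.hd' θ.hL' θ.b₀ θ.b₁ Mstar')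
    (𝔢 : SectELettersY (Matrix (Fin N) (Fin N) ℂ) x) {γ : ℝ}
    (hrow : ∀ g : IBondY x.toKIdx → ℝ, (∀ q, ¬ inΛY x q → g q = 0) → (∀ q, IsAxialY x q → g q = 0) →
      (∀ c : CBondY x, Q1Y x (avYOfRecord x) (fun _ _ => 1 : CfgY ℂ x.toKIdx) c.1 (fun q => ((g q : ℝ) : ℂ)) = 0) →
        γ * ∑ q, g q ^ 2 ≤ etaDY x * ∑ q, g q * (onFun (EE (domT x.hN x.D x.hk) x.hcf x.hw) g q - x.toKIdx.w q * g q))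
    (B : IBondY x.toKIdx → Matrix (Fin N) (Fin N) ℂ) (hΛ : ∀ q, ¬ inΛY x q → B q = 0) (hAx : ∀ q, IsAxialY x q → B q = 0)
    (hQ : ∀ c : CBondY x, Q1Y x (avYOfRecord x) (fun _ _ => 1 : CfgY (Matrix (Fin N) (Fin N) ℂ) x.toKIdx) c.1 B = 0) :
    γ * trIP (fun _ => (1 : ℝ)) B B ≤ trIP (fun _ => (1 : ℝ)) B (deltaKPY x (lettersYOfRecordV4 N θ Mstar' 𝔯 x) 𝔢 (fun _ _ => 1) B) :=
  ineq2153_one_of_scalarRow x (lettersYOfRecordV4 N θ Mstar' 𝔯 x) 𝔢 _ (lettersYOfRecordV4_QG1Qinv_one_eq_liftEndY N θ Mstar' 𝔯 x) hrow B hΛ hAx hQ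

/-- ★★ **AT THE LETTERS OF RECORD, PRINT's STAR subspace in node00-def-Y's INTERIM spelling** (the binder dag-n08-b CLAIM-16 (A)+(B) supplies; see
`ineq2153_one_of_scalarRow_star`). [cite: Balaban1984PropagatorsII, (2.153) p.249, (2.3) p.224, Lemma 2.4 p.245, (2.35) p.228; Balaban1985BackgroundPropagators, (3.156) p.428] -/
theorem ineq2153_one_lettersYOfRecordV4_of_scalarRow_star (x : MemberY θ.d₆ θ.ℓ₆ θ.hd' θ.hL' θ.b₀ θ.b₁ Mstar')
    (𝔢 : SectELettersY (Matrix (Fin N) (Fin N) ℂ) x) {γ : ℝ}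
    (hrow : ∀ g : IBondY x.toKIdx → ℝ,
      (∀ q, ¬ (lvl x.hN x.D x.hk q = x.k ∧ (GoodY x (usrc x q) ∨ GoodY x (utgt x q))) → g q = 0) → (∀ q, IsAxialY x q → g q = 0) →
      (∀ c : USiteY x × Fin (θ.d₆ + 1), IsCornerY x c.1 → Q1Y x (avYOfRecord x) (fun _ _ => 1 : CfgY ℂ x.toKIdx) c (fun q => ((g q : ℝ) : ℂ)) = 0) →
        γ * ∑ q, g q ^ 2 ≤ etaDY x * ∑ q, g q * (onFun (EE (domT x.hN x.D x.hk) x.hcf x.hw) g q - x.toKIdx.w q * g q))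
    (B : IBondY x.toKIdx → Matrix (Fin N) (Fin N) ℂ)
    (hΛ : ∀ q, ¬ (lvl x.hN x.D x.hk q = x.k ∧ (GoodY x (usrc x q) ∨ GoodY x (utgt x q))) → B q = 0) (hAx : ∀ q, IsAxialY x q → B q = 0)
    (hQ : ∀ c : USiteY x × Fin (θ.d₆ + 1), IsCornerY x c.1 → Q1Y x (avYOfRecord x) (fun _ _ => 1 : CfgY (Matrix (Fin N) (Fin N) ℂ) x.toKIdx) c B = 0) :
    γ * trIP (fun _ => (1 : ℝ)) B B ≤ trIP (fun _ => (1 : ℝ)) B (deltaKPY x (lettersYOfRecordV4 N θ Mstar' 𝔯 x) 𝔢 (fun _ _ => 1) B) :=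
  ineq2153_one_of_scalarRow_star x (lettersYOfRecordV4 N θ Mstar' 𝔯 x) 𝔢 _ (lettersYOfRecordV4_QG1Qinv_one_eq_liftEndY N θ Mstar' 𝔯 x) hrow B hΛ hAx hQ

end Reduction

/-! ## §4 ★★ THE STAR-CORNER BRIDGE: for a bond function supported on print's STAR set of bonds, the constraint `(Q(1)B)(c) = 0` is AUTOMATIC at
every block-corner bond `c = (y, μ)` whose two end blocks `B(c₋)`, `B(c₊)` are both non-good — so the rows with constraints at EVERY corner (§3 `_star`,
dag-n08-b's discharged `scalarRow_star` ∕ `ineq2153_one_star`) serve fields carrying the constraint only at node00-def-Y's star-coarse corners `IsCoarseStY`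
(the index set the STAR EDITION's elimination `C` solves for) -/

section StarCorner

open B9PinMembersKLevelV1 (MemberY)
open B6BondElimination (unitVec unitVec_apply)
open B6Elimination (corner mem_block corner_apply corner_eq_of_mem_block)
open B6GlobalChartV1 (PV domT)
open B6Ineq2142KLevelV1 (lvl)
open B6SectAVectorModelV1 (EE)
open B6Ineq2133TwoScaleV1 (onFun)

variable {N : ℕ} {d ℓ : ℕ} {hd : 1 ≤ d + 1} {hL : Odd (ℓ + 1) ∧ 1 < ℓ + 1} {b₀ b₁ : ℝ} {Mstar : ℕ}
variable (x : MemberY d ℓ hd hL b₀ b₁ Mstar)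

/-- **BLOCK POINTS BY OFFSET**: for an `L`-lattice point `y` and an integer offset `r` with `0 ≤ r_i ≤ L − 1` in every direction, the unit site with label
`labK y + r` lies in the block `B(y)` (all `L^{d+1}` sites of the block are so obtained). [cite: Balaban1984PropagatorsI, (1.6) p.18; Balaban1985Averaging, p.24, bookkeeping] -/
theorem ofZ_add_mem_ublockY_of_le {y : USiteY x} (hy : IsCornerY x y) {r : Fin (d + 1) → ℤ} (h0 : ∀ i, 0 ≤ r i) (h1 : ∀ i, r i ≤ ℓ) :
    ofZ x (labK x y + r) ∈ ublockY x y := by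
  have hmem : labK x y + r ∈ B6Elimination.block (ℓ + 1) (corner (ℓ + 1) (labK x y)) := by
    rw [(isCornerY_iff x y).1 hy, mem_block]
    intro i
    rw [Pi.add_apply]
    have := h0 i
    have := h1 i
    constructor
    · linarith
    · push_cast; linarith
  rw [mem_ublockY, labK_ofZ x (inBox_of_mem_block x hmem), corner_eq_of_mem_block ell_succ_pos hmem]

/-- the label chart is a section of `ofZ` also under translation: `ofZ (labK u + v) = ofZ (w + v)` whenever `ofZ w = u` (labels are read modulo the
period). [cite: Balaban1984PropagatorsII, (2.1) p.224, bookkeeping] -/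
theorem ofZ_labK_add_eq (u : USiteY x) {w : Fin (d + 1) → ℤ} (h : ofZ x w = u) (v : Fin (d + 1) → ℤ) :
    ofZ x (labK x u + v) = ofZ x (w + v) := by
  subst h
  funext i
  simp [ofZ, labK]

/-- **THE NEXT CORNER IS A CORNER**: `y + L·e_μ` (reduced around the torus) is an `L`-lattice point whenever `y` is (the period `L·M_h·P′_μ` of the unit
torus is a multiple of `L`). [cite: Balaban1984PropagatorsII, (2.1) p.224; Balaban1985BackgroundPropagators, (3.157) p.428, bookkeeping] -/
theorem isCornerY_unextY {y : USiteY x} (hy : IsCornerY x y) (μ : Fin (d + 1)) : IsCornerY x (unextY x y μ) := by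
  have hcy := (isCornerY_iff x y).1 hy
  rw [isCornerY_iff]
  funext i
  rw [corner_apply]
  have hL0 : ((ℓ + 1 : ℕ) : ℤ) ≠ 0 := by exact_mod_cast Nat.succ_ne_zero ℓ
  -- `L ∣ labK (y + L e_μ) i`: the label is the remainder of `labK y i + L·[i = μ]` modulo the period, all three multiples of `L`
  have hval : labK x (unextY x y μ) i =
      (labK x y i + ((ℓ + 1 : ℕ) : ℤ) * unitVec μ i) % (((PV d ℓ x.m x.K hd hL).sitesPerDir x.k : ℕ) : ℤ) := by
    show (((unextY x y μ i).val : ℕ) : ℤ) = _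
    rw [show unextY x y μ i = (((labK x y i + ((ℓ + 1 : ℕ) : ℤ) * unitVec μ i : ℤ)) : ZMod ((PV d ℓ x.m x.K hd hL).sitesPerDir x.k)) from by
      simp only [unextY, ofZ_apply, Pi.add_apply, Pi.smul_apply, smul_eq_mul]]
    rw [ZMod.val_intCast]
  have h1 : ((ℓ + 1 : ℕ) : ℤ) ∣ labK x y i := by
    have e := congrFun hcy i
    rw [corner_apply] at e
    exact ⟨_, e.symm⟩
  have h2 : ((ℓ + 1 : ℕ) : ℤ) ∣ (((PV d ℓ x.m x.K hd hL).sitesPerDir x.k : ℕ) : ℤ) := by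
    rw [sitesPerDir_k x i]; push_cast; exact Dvd.intro _ rfl
  have h3 : ((ℓ + 1 : ℕ) : ℤ) ∣ labK x (unextY x y μ) i := by
    rw [hval, Int.emod_def]
    exact Dvd.dvd.sub (h1.add (Dvd.intro _ rfl)) (h2.mul_right _)
  obtain ⟨q, hq⟩ := h3
  rw [hq, Int.mul_ediv_cancel_left _ hL0]

/-- ★ **THE SEGMENT DICHOTOMY**: for an `L`-lattice point `y`, a block point `z ∈ B(y)` and an offset `0 ≤ t ≤ L` in direction `μ`, the unit site
`z + t·e_μ` lies in `B(y)` or in the next block `B(y + L·e_μ)` — the unit sites visited by the straight segments `[z, z + L·e_μ]` of `(Q(1)·)(y, μ)`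
((125) at `V = 1`) lie in `B(c₋) ∪ B(c₊)`.  (The torus seam needs no case split: the identity `z + t e_μ = (y + L e_μ) + (z − y + (t − L) e_μ)` is read
in `ZMod`.) [cite: Balaban1985Averaging, (14) p.19, (125) p.36; Balaban1984PropagatorsI, (1.6) p.18, bookkeeping] -/
theorem ofZ_labK_add_smul_mem_ublockY_or {y : USiteY x} (hy : IsCornerY x y) {z : USiteY x} (hz : z ∈ ublockY x y)
    (μ : Fin (d + 1)) {t : ℤ} (h0 : 0 ≤ t) (ht : t ≤ ℓ + 1) :
    ofZ x (labK x z + t • unitVec μ) ∈ ublockY x y ∨ ofZ x (labK x z + t • unitVec μ) ∈ ublockY x (unextY x y μ) := by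
  have hcy := (isCornerY_iff x y).1 hy
  have hzb := labK_mem_block_of_mem_ublockY x hz
  rw [hcy, mem_block] at hzb
  by_cases hc : labK x z μ + t ≤ labK x y μ + ℓ
  · left
    have e : labK x z + t • unitVec μ = labK x y + (labK x z - labK x y + t • unitVec μ) := by abel
    rw [e]
    refine ofZ_add_mem_ublockY_of_le x hy (fun i => ?_) (fun i => ?_)
    · rw [Pi.add_apply, Pi.sub_apply, Pi.smul_apply, unitVec_apply, smul_eq_mul]
      have := (hzb i).1
      split_ifs <;> linarith
    · rw [Pi.add_apply, Pi.sub_apply, Pi.smul_apply, unitVec_apply, smul_eq_mul]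
      have := (hzb i).2
      split_ifs with hi
      · subst hi; linarith
      · push_cast at this; linarith
  · right
    push Not at hc
    have e : labK x z + t • unitVec μ =
        (labK x y + (((ℓ + 1 : ℕ) : ℤ)) • unitVec μ) + (labK x z - labK x y + (t - ((ℓ + 1 : ℕ) : ℤ)) • unitVec μ) := by
      funext i
      simp only [Pi.add_apply, Pi.sub_apply, Pi.smul_apply, smul_eq_mul]
      ring
    rw [e, ← ofZ_labK_add_eq x (unextY x y μ) rfl]
    refine ofZ_add_mem_ublockY_of_le x (isCornerY_unextY x hy μ) (fun i => ?_) (fun i => ?_)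
    · rw [Pi.add_apply, Pi.sub_apply, Pi.smul_apply, unitVec_apply, smul_eq_mul]
      have := (hzb i).1
      split_ifs with hi
      · subst hi; push_cast; linarith
      · linarith
    · rw [Pi.add_apply, Pi.sub_apply, Pi.smul_apply, unitVec_apply, smul_eq_mul]
      have := (hzb i).2
      split_ifs with hi
      · subst hi; push_cast at this ⊢; linarith
      · push_cast at this; linarith

/-- hence: if a unit site of a segment of `(Q(1)·)(y, μ)` is good, one of the two end blocks of the coarse bond is good.
[cite: Balaban1985BackgroundPropagators, p.427 («Λ′ … a sum of unit blocks»), (3.157) p.428, bookkeeping] -/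
theorem goodY_or_of_goodY_seg {y : USiteY x} (hy : IsCornerY x y) {z : USiteY x} (hz : z ∈ ublockY x y) (μ : Fin (d + 1))
    {t : ℤ} (h0 : 0 ≤ t) (ht : t ≤ ℓ + 1) (hg : GoodY x (ofZ x (labK x z + t • unitVec μ))) :
    GoodY x y ∨ GoodY x (unextY x y μ) :=
  (ofZ_labK_add_smul_mem_ublockY_or x hy hz μ h0 ht).imp
    (fun h => (goodY_iff_of_blockOf_eq x (blockOf_eq_of_mem_ublockY x h)).1 hg)
    (fun h => (goodY_iff_of_blockOf_eq x (blockOf_eq_of_mem_ublockY x h)).1 hg)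

/-- the target of a segment bond in the chart: `[z + s e_μ, μ]₊ = z + (s+1) e_μ`. [cite: Balaban1985Averaging, (14) p.19, bookkeeping] -/
theorem seg_tgt_eq (z : USiteY x) (μ : Fin (d + 1)) (s : ℤ) :
    (⟨ofZ x (labK x z + s • unitVec μ), μ⟩ : UBondY x).tgt = ofZ x (labK x z + (s + 1) • unitVec μ) := by
  show (ofZ x (labK x z + s • unitVec μ)).shift μ = _
  rw [← ofZ_add_unitVec, add_smul, one_smul, add_assoc]

/-- ★ **STAR SUPPORT KILLS THE READING ALONG NON-GOOD COARSE BONDS**: if `B` vanishes at every index bond not in print's STAR set (top level, at least one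
end block good — [4] (2.3) p. 224), then along the segments of a block-corner bond `c = (y, μ)` with BOTH `B(y)` and `B(y + L e_μ)` non-good the unit-bond
reading of `B` is `0` (each segment bond has both end blocks among these two). Any fibre `𝔸`.
[cite: Balaban1984PropagatorsII, (2.3) p.224, Lemma 2.4 p.245; Balaban1985Averaging, (125) p.36, bookkeeping] -/
theorem readUY_seg_eq_zero_of_starSupport {𝔸 : Type} [NormedRing 𝔸] [NormedAlgebra ℂ 𝔸] [CompleteSpace 𝔸] (B : IBondY x.toKIdx → 𝔸)
    (hΛst : ∀ q : IBondY x.toKIdx, ¬ (lvl x.hN x.D x.hk q = x.k ∧ (GoodY x (usrc x q) ∨ GoodY x (utgt x q))) → B q = 0)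
    {y : USiteY x} (hy : IsCornerY x y) {μ : Fin (d + 1)} (hn₁ : ¬ GoodY x y) (hn₂ : ¬ GoodY x (unextY x y μ))
    {z : USiteY x} (hz : z ∈ ublockY x y) {s : ℕ} (hs : s < ℓ + 1) :
    readUY x B ⟨ofZ x (labK x z + (s : ℤ) • unitVec μ), μ⟩ = 0 := by
  by_cases h : (⟨ofZ x (labK x z + (s : ℤ) • unitVec μ), μ⟩ : UBondY x).src ∈ (domT x.hN x.D x.hk).Om x.k
  · rw [readUY_apply_of_mem x B h]
    apply hΛst
    rintro ⟨-, hg | hg⟩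
    · rw [usrc_idxOfU] at hg
      exact (goodY_or_of_goodY_seg x hy hz μ (by positivity) (by exact_mod_cast hs.le) hg).elim hn₁ hn₂
    · rw [utgt_idxOfU, seg_tgt_eq] at hg
      exact (goodY_or_of_goodY_seg x hy hz μ (by positivity) (by exact_mod_cast Nat.succ_le_of_lt hs) hg).elim hn₁ hn₂
  · exact readUY_apply_of_not_mem x B h

/-- ★★ **THE CONSTRAINT IS AUTOMATIC AT NON-STAR CORNERS**: for `B` supported on print's star set of bonds, `(Q(1)B)(c) = 0` at every block-corner bond
`c = (y, μ)` of the unit lattice with both end blocks `B(c₋)`, `B(c₊)` non-good (the `V = 1` block–segment average of §2 `Q1Y_avYOfRecord_one_eq` reads only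
zeros) — the clause «the corners with both end blocks non-good are automatic» of §3 `ineq2153_one_of_scalarRow_star`. Any fibre `𝔸`.
[cite: Balaban1985Averaging, (125) p.36; Balaban1984PropagatorsII, (2.3) p.224, Lemma 2.4 p.245; Balaban1985BackgroundPropagators, (3.157) p.428] -/
theorem Q1Y_avYOfRecord_one_eq_zero_of_starSupport {𝔸 : Type} [NormedRing 𝔸] [NormedAlgebra ℂ 𝔸] [CompleteSpace 𝔸]
    (B : IBondY x.toKIdx → 𝔸)
    (hΛst : ∀ q : IBondY x.toKIdx, ¬ (lvl x.hN x.D x.hk q = x.k ∧ (GoodY x (usrc x q) ∨ GoodY x (utgt x q))) → B q = 0)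
    {c : USiteY x × Fin (d + 1)} (hc : IsCornerY x c.1) (hn₁ : ¬ GoodY x c.1) (hn₂ : ¬ GoodY x (unextY x c.1 c.2)) :
    Q1Y x (avYOfRecord x) (fun _ _ => 1 : CfgY 𝔸 x.toKIdx) c B = 0 := by
  rw [Q1Y_avYOfRecord_one_eq]
  refine smul_eq_zero_of_right _ (Finset.sum_eq_zero fun z hz => Finset.sum_eq_zero fun s hs => ?_)
  exact readUY_seg_eq_zero_of_starSupport x B hΛst hc hn₁ hn₂ hz (Finset.mem_range.1 hs)

/-- ★★ **FROM STAR-COARSE CONSTRAINTS TO ALL-CORNER CONSTRAINTS**: for `B` supported on print's star set, the constraints at node00-def-Y's star-coarse corners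
(`IsCoarseStY c` ↔ `IsCornerY c.1 ∧ (GoodY c.1 ∨ GoodY (c.1 + L e_{c.2}))` — the index set of the star edition's pivots) give the constraints at EVERY
block-corner bond (the binder `hQ` of §3 `ineq2153_one_of_scalarRow_star` and of dag-n08-b's `scalarRow_star` ∕ `ineq2153_one_star`). Any fibre `𝔸`.
[cite: Balaban1985BackgroundPropagators, (3.157) p.428; Balaban1984PropagatorsII, (2.3) p.224, Lemma 2.4 p.245; Balaban1985Averaging, (125) p.36] -/
theorem Q1Y_one_eq_zero_of_isCornerY_of_coarseSt {𝔸 : Type} [NormedRing 𝔸] [NormedAlgebra ℂ 𝔸] [CompleteSpace 𝔸]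
    (B : IBondY x.toKIdx → 𝔸)
    (hΛst : ∀ q : IBondY x.toKIdx, ¬ (lvl x.hN x.D x.hk q = x.k ∧ (GoodY x (usrc x q) ∨ GoodY x (utgt x q))) → B q = 0)
    (hQst : ∀ c : USiteY x × Fin (d + 1), IsCornerY x c.1 → (GoodY x c.1 ∨ GoodY x (unextY x c.1 c.2)) →
      Q1Y x (avYOfRecord x) (fun _ _ => 1 : CfgY 𝔸 x.toKIdx) c B = 0)
    (c : USiteY x × Fin (d + 1)) (hc : IsCornerY x c.1) :
    Q1Y x (avYOfRecord x) (fun _ _ => 1 : CfgY 𝔸 x.toKIdx) c B = 0 := by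
  by_cases h : GoodY x c.1 ∨ GoodY x (unextY x c.1 c.2)
  · exact hQst c hc h
  · push Not at h
    exact Q1Y_avYOfRecord_one_eq_zero_of_starSupport x B hΛst hc h.1 h.2

/-- ★ **THE TWO READINGS OF «`c ∈ Λ′`» GIVE THE SAME ROW ON THE STAR SUBSPACE**: a property `P` holds for every real bond function on the star subspace with
`Q(1)`-constraints at EVERY block corner iff it holds for every real bond function on the star subspace with `Q(1)`-constraints only at the STAR-COARSE corners
(at least one end block good).  (⇐ is weakening; ⇒ is `Q1Y_one_eq_zero_of_isCornerY_of_coarseSt` at the fibre `ℂ`.)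
[cite: Balaban1984PropagatorsII, (2.3) p.224, Lemma 2.4 p.245, (2.153) p.249; Balaban1985BackgroundPropagators, (3.156)–(3.157) p.428] -/
theorem scalarRow_coarseSt_iff_star (P : (IBondY x.toKIdx → ℝ) → Prop) :
    (∀ g : IBondY x.toKIdx → ℝ,
      (∀ q, ¬ (lvl x.hN x.D x.hk q = x.k ∧ (GoodY x (usrc x q) ∨ GoodY x (utgt x q))) → g q = 0) → (∀ q, IsAxialY x q → g q = 0) →
      (∀ c : USiteY x × Fin (d + 1), IsCornerY x c.1 → (GoodY x c.1 ∨ GoodY x (unextY x c.1 c.2)) →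
        Q1Y x (avYOfRecord x) (fun _ _ => 1 : CfgY ℂ x.toKIdx) c (fun q => ((g q : ℝ) : ℂ)) = 0) → P g) ↔
    (∀ g : IBondY x.toKIdx → ℝ,
      (∀ q, ¬ (lvl x.hN x.D x.hk q = x.k ∧ (GoodY x (usrc x q) ∨ GoodY x (utgt x q))) → g q = 0) → (∀ q, IsAxialY x q → g q = 0) →
      (∀ c : USiteY x × Fin (d + 1), IsCornerY x c.1 →
        Q1Y x (avYOfRecord x) (fun _ _ => 1 : CfgY ℂ x.toKIdx) c (fun q => ((g q : ℝ) : ℂ)) = 0) → P g) := by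
  constructor
  · intro h g hZ hAx hQ
    exact h g hZ hAx fun c hc _ => hQ c hc
  · intro h g hZ hAx hQst
    refine h g hZ hAx (Q1Y_one_eq_zero_of_isCornerY_of_coarseSt x _ (fun q hq => ?_) hQst)
    rw [hZ q hq, Complex.ofReal_zero]

/-- ★★ **THE MATRIX Δ_k-ROW FOR FIELDS CONSTRAINED ONLY AT THE STAR-COARSE CORNERS** (the binder the STAR EDITION's transfer `B := C(1)Φ` produces: `B = 0` off
the star set and on the axial trees, `(Q(1)B)(c) = 0` at the letters' constraint corners `IsCoarseStY c`), FROM the scalar row with constraints at every corner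
(the shape dag-n08-b's `scalarRow_star` discharges): §3 `ineq2153_one_of_scalarRow_star` with its `hQ` supplied by `Q1Y_one_eq_zero_of_isCornerY_of_coarseSt`.
[cite: Balaban1984PropagatorsII, (2.153) p.249, (2.3) p.224, Lemma 2.4 p.245; Balaban1985BackgroundPropagators, (3.156)–(3.157) p.428] -/
theorem ineq2153_one_of_scalarRow_star_coarseSt (𝔏 : CovLettersY (Matrix (Fin N) (Fin N) ℂ) x) (𝔢 : SectELettersY (Matrix (Fin N) (Fin N) ℂ) x)
    (T₀ : Module.End ℝ (IBondY x.toKIdx → ℝ)) (hT : 𝔏.QG1Qinv (fun _ _ => 1) = liftEndY (Matrix (Fin N) (Fin N) ℂ) T₀) {γ : ℝ}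
    (hrow : ∀ g : IBondY x.toKIdx → ℝ,
      (∀ q, ¬ (lvl x.hN x.D x.hk q = x.k ∧ (GoodY x (usrc x q) ∨ GoodY x (utgt x q))) → g q = 0) → (∀ q, IsAxialY x q → g q = 0) →
      (∀ c : USiteY x × Fin (d + 1), IsCornerY x c.1 → Q1Y x (avYOfRecord x) (fun _ _ => 1 : CfgY ℂ x.toKIdx) c (fun q => ((g q : ℝ) : ℂ)) = 0) →
        γ * ∑ q, g q ^ 2 ≤ etaDY x * ∑ q, g q * (T₀ g q - x.toKIdx.w q * g q))
    (B : IBondY x.toKIdx → Matrix (Fin N) (Fin N) ℂ)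
    (hΛ : ∀ q, ¬ (lvl x.hN x.D x.hk q = x.k ∧ (GoodY x (usrc x q) ∨ GoodY x (utgt x q))) → B q = 0) (hAx : ∀ q, IsAxialY x q → B q = 0)
    (hQ : ∀ c : USiteY x × Fin (d + 1), IsCornerY x c.1 → (GoodY x c.1 ∨ GoodY x (unextY x c.1 c.2)) →
      Q1Y x (avYOfRecord x) (fun _ _ => 1 : CfgY (Matrix (Fin N) (Fin N) ℂ) x.toKIdx) c B = 0) :
    γ * trIP (fun _ => (1 : ℝ)) B B ≤ trIP (fun _ => (1 : ℝ)) B (deltaKPY x 𝔏 𝔢 (fun _ _ => 1) B) :=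
  ineq2153_one_of_scalarRow_star x 𝔏 𝔢 T₀ hT hrow B hΛ hAx (Q1Y_one_eq_zero_of_isCornerY_of_coarseSt x B hΛ hQ)

/-- ★★ **THE SAME WITH THE SCALAR ROW ALSO CONSTRAINED ONLY AT THE STAR-COARSE CORNERS** (both sides in node00-def-Y's star-coarse reading; an instance of
§3 `ineq2153_one_of_scalarRow_on` with `Z = ¬star ∨ axial`, `S = star-coarse`). [cite: Balaban1984PropagatorsII, (2.153) p.249, (2.3) p.224, Lemma 2.4 p.245; Balaban1985BackgroundPropagators, (3.156)–(3.157) p.428] -/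
theorem ineq2153_one_of_scalarRow_coarseSt (𝔏 : CovLettersY (Matrix (Fin N) (Fin N) ℂ) x) (𝔢 : SectELettersY (Matrix (Fin N) (Fin N) ℂ) x)
    (T₀ : Module.End ℝ (IBondY x.toKIdx → ℝ)) (hT : 𝔏.QG1Qinv (fun _ _ => 1) = liftEndY (Matrix (Fin N) (Fin N) ℂ) T₀) {γ : ℝ}
    (hrow : ∀ g : IBondY x.toKIdx → ℝ,
      (∀ q, ¬ (lvl x.hN x.D x.hk q = x.k ∧ (GoodY x (usrc x q) ∨ GoodY x (utgt x q))) → g q = 0) → (∀ q, IsAxialY x q → g q = 0) →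
      (∀ c : USiteY x × Fin (d + 1), IsCornerY x c.1 → (GoodY x c.1 ∨ GoodY x (unextY x c.1 c.2)) →
        Q1Y x (avYOfRecord x) (fun _ _ => 1 : CfgY ℂ x.toKIdx) c (fun q => ((g q : ℝ) : ℂ)) = 0) →
        γ * ∑ q, g q ^ 2 ≤ etaDY x * ∑ q, g q * (T₀ g q - x.toKIdx.w q * g q))
    (B : IBondY x.toKIdx → Matrix (Fin N) (Fin N) ℂ)
    (hΛ : ∀ q, ¬ (lvl x.hN x.D x.hk q = x.k ∧ (GoodY x (usrc x q) ∨ GoodY x (utgt x q))) → B q = 0) (hAx : ∀ q, IsAxialY x q → B q = 0)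
    (hQ : ∀ c : USiteY x × Fin (d + 1), IsCornerY x c.1 → (GoodY x c.1 ∨ GoodY x (unextY x c.1 c.2)) →
      Q1Y x (avYOfRecord x) (fun _ _ => 1 : CfgY (Matrix (Fin N) (Fin N) ℂ) x.toKIdx) c B = 0) :
    γ * trIP (fun _ => (1 : ℝ)) B B ≤ trIP (fun _ => (1 : ℝ)) B (deltaKPY x 𝔏 𝔢 (fun _ _ => 1) B) :=
  ineq2153_one_of_scalarRow_on x 𝔏 𝔢 T₀ hT
    (fun q => ¬ (lvl x.hN x.D x.hk q = x.k ∧ (GoodY x (usrc x q) ∨ GoodY x (utgt x q))) ∨ IsAxialY x q)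
    (fun c => IsCornerY x c.1 ∧ (GoodY x c.1 ∨ GoodY x (unextY x c.1 c.2)))
    (fun g hZ hS => hrow g (fun q hq => hZ q (Or.inl hq)) (fun q hq => hZ q (Or.inr hq)) fun c hc hg => hS c ⟨hc, hg⟩)
    B (fun q hq => hq.elim (hΛ q) (hAx q)) fun c hc => hQ c hc.1 hc.2

variable (N) (θ : Stage3Params) (Mstar' : ℕ) (𝔯 : ResY N θ Mstar')

/-- ★★ **AT THE LETTERS OF RECORD** (`T₀ = onFun (EE (domT …) …)`, any residual family `𝔯`, any Sect. E letters `𝔢`): the matrix Δ_k-row for fields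
constrained only at the star-coarse corners, from the all-corner scalar row (dag-n08-b's `scalarRow_star` shape).
[cite: Balaban1984PropagatorsII, (2.153) p.249, (2.3) p.224, Lemma 2.4 p.245, (2.35) p.228; Balaban1985BackgroundPropagators, (3.156)–(3.157) p.428] -/
theorem ineq2153_one_lettersYOfRecordV4_of_scalarRow_star_coarseSt (x : MemberY θ.d₆ θ.ℓ₆ θ.hd' θ.hL' θ.b₀ θ.b₁ Mstar')
    (𝔢 : SectELettersY (Matrix (Fin N) (Fin N) ℂ) x) {γ : ℝ}
    (hrow : ∀ g : IBondY x.toKIdx → ℝ,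
      (∀ q, ¬ (lvl x.hN x.D x.hk q = x.k ∧ (GoodY x (usrc x q) ∨ GoodY x (utgt x q))) → g q = 0) → (∀ q, IsAxialY x q → g q = 0) →
      (∀ c : USiteY x × Fin (θ.d₆ + 1), IsCornerY x c.1 → Q1Y x (avYOfRecord x) (fun _ _ => 1 : CfgY ℂ x.toKIdx) c (fun q => ((g q : ℝ) : ℂ)) = 0) →
        γ * ∑ q, g q ^ 2 ≤ etaDY x * ∑ q, g q * (onFun (EE (domT x.hN x.D x.hk) x.hcf x.hw) g q - x.toKIdx.w q * g q))
    (B : IBondY x.toKIdx → Matrix (Fin N) (Fin N) ℂ)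
    (hΛ : ∀ q, ¬ (lvl x.hN x.D x.hk q = x.k ∧ (GoodY x (usrc x q) ∨ GoodY x (utgt x q))) → B q = 0) (hAx : ∀ q, IsAxialY x q → B q = 0)
    (hQ : ∀ c : USiteY x × Fin (θ.d₆ + 1), IsCornerY x c.1 → (GoodY x c.1 ∨ GoodY x (unextY x c.1 c.2)) →
      Q1Y x (avYOfRecord x) (fun _ _ => 1 : CfgY (Matrix (Fin N) (Fin N) ℂ) x.toKIdx) c B = 0) :
    γ * trIP (fun _ => (1 : ℝ)) B B ≤ trIP (fun _ => (1 : ℝ)) B (deltaKPY x (lettersYOfRecordV4 N θ Mstar' 𝔯 x) 𝔢 (fun _ _ => 1) B) :=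
  ineq2153_one_of_scalarRow_star_coarseSt x (lettersYOfRecordV4 N θ Mstar' 𝔯 x) 𝔢 _ (lettersYOfRecordV4_QG1Qinv_one_eq_liftEndY N θ Mstar' 𝔯 x)
    hrow B hΛ hAx hQ

/-- ★★ **AT THE LETTERS OF RECORD, both sides in the star-coarse reading.** [cite: Balaban1984PropagatorsII, (2.153) p.249, (2.3) p.224, Lemma 2.4 p.245, (2.35) p.228; Balaban1985BackgroundPropagators, (3.156)–(3.157) p.428] -/
theorem ineq2153_one_lettersYOfRecordV4_of_scalarRow_coarseSt (x : MemberY θ.d₆ θ.ℓ₆ θ.hd' θ.hL' θ.b₀ θ.b₁ Mstar')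
    (𝔢 : SectELettersY (Matrix (Fin N) (Fin N) ℂ) x) {γ : ℝ}
    (hrow : ∀ g : IBondY x.toKIdx → ℝ,
      (∀ q, ¬ (lvl x.hN x.D x.hk q = x.k ∧ (GoodY x (usrc x q) ∨ GoodY x (utgt x q))) → g q = 0) → (∀ q, IsAxialY x q → g q = 0) →
      (∀ c : USiteY x × Fin (θ.d₆ + 1), IsCornerY x c.1 → (GoodY x c.1 ∨ GoodY x (unextY x c.1 c.2)) →
        Q1Y x (avYOfRecord x) (fun _ _ => 1 : CfgY ℂ x.toKIdx) c (fun q => ((g q : ℝ) : ℂ)) = 0) →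
        γ * ∑ q, g q ^ 2 ≤ etaDY x * ∑ q, g q * (onFun (EE (domT x.hN x.D x.hk) x.hcf x.hw) g q - x.toKIdx.w q * g q))
    (B : IBondY x.toKIdx → Matrix (Fin N) (Fin N) ℂ)
    (hΛ : ∀ q, ¬ (lvl x.hN x.D x.hk q = x.k ∧ (GoodY x (usrc x q) ∨ GoodY x (utgt x q))) → B q = 0) (hAx : ∀ q, IsAxialY x q → B q = 0)
    (hQ : ∀ c : USiteY x × Fin (θ.d₆ + 1), IsCornerY x c.1 → (GoodY x c.1 ∨ GoodY x (unextY x c.1 c.2)) →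
      Q1Y x (avYOfRecord x) (fun _ _ => 1 : CfgY (Matrix (Fin N) (Fin N) ℂ) x.toKIdx) c B = 0) :
    γ * trIP (fun _ => (1 : ℝ)) B B ≤ trIP (fun _ => (1 : ℝ)) B (deltaKPY x (lettersYOfRecordV4 N θ Mstar' 𝔯 x) 𝔢 (fun _ _ => 1) B) :=
  ineq2153_one_of_scalarRow_coarseSt x (lettersYOfRecordV4 N θ Mstar' 𝔯 x) 𝔢 _ (lettersYOfRecordV4_QG1Qinv_one_eq_liftEndY N θ Mstar' 𝔯 x)
    hrow B hΛ hAx hQ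

end StarCorner

/-! ## §5 (v1.1) The same bridge keyed BY NAME to node00-def-Y's STAR EDITION part 1 (`Node00/OpsYSectEStarGeometry`, p689888): variables `inΛstY`,
constraint index `CBondStY` ∕ `IsCoarseStY` — the binders the star letters' elimination `C` (parts 2–3) produces -/

section StarNamed

open B9PinMembersKLevelV1 (MemberY)
open B6GlobalChartV1 (domT)
open B6Ineq2142KLevelV1 (lvl)
open B6SectAVectorModelV1 (EE)
open B6Ineq2133TwoScaleV1 (onFun)

variable {N : ℕ} {d ℓ : ℕ} {hd : 1 ≤ d + 1} {hL : Odd (ℓ + 1) ∧ 1 < ℓ + 1} {b₀ b₁ : ℝ} {Mstar : ℕ}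
variable (x : MemberY d ℓ hd hL b₀ b₁ Mstar)

/-- ★★ **STAR-EDITION BINDERS ⇒ ALL-CORNER CONSTRAINTS**: for `B` vanishing off def-Y's star variables `inΛstY` with `(Q(1)B)(c) = 0` at def-Y's star-coarse
bonds `c : CBondStY x`, the constraint holds at EVERY block-corner bond (§4 `Q1Y_one_eq_zero_of_isCornerY_of_coarseSt`, re-keyed by `inΛstY_iff` ∕
`mem_coarseStY`). Any fibre `𝔸`. [cite: Balaban1985BackgroundPropagators, (3.157) p.428; Balaban1984PropagatorsII, (2.3) p.224, Lemma 2.4 p.245; Balaban1985Averaging, (125) p.36] -/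
theorem Q1Y_one_eq_zero_of_isCornerY_of_CBondStY {𝔸 : Type} [NormedRing 𝔸] [NormedAlgebra ℂ 𝔸] [CompleteSpace 𝔸]
    (B : IBondY x.toKIdx → 𝔸) (hΛst : ∀ q : IBondY x.toKIdx, ¬ inΛstY x q → B q = 0)
    (hQst : ∀ c : CBondStY x, Q1Y x (avYOfRecord x) (fun _ _ => 1 : CfgY 𝔸 x.toKIdx) c.1 B = 0)
    (c : USiteY x × Fin (d + 1)) (hc : IsCornerY x c.1) :
    Q1Y x (avYOfRecord x) (fun _ _ => 1 : CfgY 𝔸 x.toKIdx) c B = 0 :=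
  Q1Y_one_eq_zero_of_isCornerY_of_coarseSt x B (fun q hq => hΛst q fun h => hq ((inΛstY_iff x q).1 h))
    (fun c' hc' hg => hQst ⟨c', (mem_coarseStY x).2 ⟨hc', hg⟩⟩) c hc

/-- ★★ **THE MATRIX Δ_k-ROW FOR THE STAR LETTERS' FIELDS** (`B = 0` off `inΛstY` and on the axial trees, `(Q(1)B)(c) = 0` for `c : CBondStY x` — the shape
the star edition's transfer `B := C(1)Φ` yields), FROM the all-corner scalar row (the shape dag-n08-b's `scalarRow_star` discharges, p688936): §3
`ineq2153_one_of_scalarRow_star` with `hQ` from `Q1Y_one_eq_zero_of_isCornerY_of_CBondStY`.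
[cite: Balaban1984PropagatorsII, (2.153) p.249, (2.3) p.224, Lemma 2.4 p.245; Balaban1985BackgroundPropagators, (3.156)–(3.157) p.428] -/
theorem ineq2153_one_of_scalarRow_star_st (𝔏 : CovLettersY (Matrix (Fin N) (Fin N) ℂ) x) (𝔢 : SectELettersY (Matrix (Fin N) (Fin N) ℂ) x)
    (T₀ : Module.End ℝ (IBondY x.toKIdx → ℝ)) (hT : 𝔏.QG1Qinv (fun _ _ => 1) = liftEndY (Matrix (Fin N) (Fin N) ℂ) T₀) {γ : ℝ}
    (hrow : ∀ g : IBondY x.toKIdx → ℝ,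
      (∀ q, ¬ (lvl x.hN x.D x.hk q = x.k ∧ (GoodY x (usrc x q) ∨ GoodY x (utgt x q))) → g q = 0) → (∀ q, IsAxialY x q → g q = 0) →
      (∀ c : USiteY x × Fin (d + 1), IsCornerY x c.1 → Q1Y x (avYOfRecord x) (fun _ _ => 1 : CfgY ℂ x.toKIdx) c (fun q => ((g q : ℝ) : ℂ)) = 0) →
        γ * ∑ q, g q ^ 2 ≤ etaDY x * ∑ q, g q * (T₀ g q - x.toKIdx.w q * g q))
    (B : IBondY x.toKIdx → Matrix (Fin N) (Fin N) ℂ) (hΛ : ∀ q, ¬ inΛstY x q → B q = 0) (hAx : ∀ q, IsAxialY x q → B q = 0)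
    (hQ : ∀ c : CBondStY x, Q1Y x (avYOfRecord x) (fun _ _ => 1 : CfgY (Matrix (Fin N) (Fin N) ℂ) x.toKIdx) c.1 B = 0) :
    γ * trIP (fun _ => (1 : ℝ)) B B ≤ trIP (fun _ => (1 : ℝ)) B (deltaKPY x 𝔏 𝔢 (fun _ _ => 1) B) :=
  ineq2153_one_of_scalarRow_star x 𝔏 𝔢 T₀ hT hrow B (fun q hq => hΛ q fun h => hq ((inΛstY_iff x q).1 h)) hAx
    (Q1Y_one_eq_zero_of_isCornerY_of_CBondStY x B hΛ hQ)

variable (N) (θ : Stage3Params) (Mstar' : ℕ) (𝔯 : ResY N θ Mstar')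

/-- ★★ **AT THE LETTERS OF RECORD, STAR-EDITION BINDERS** (`T₀ = onFun (EE (domT …) …)`; any residual family `𝔯`, any Sect. E letters `𝔢`): the matrix
Δ_k-row for `B = 0` off `inΛstY` ∕ on the axial trees with `(Q(1)B)(c) = 0` at `c : CBondStY x`, from the all-corner scalar row (dag-n08-b's
`scalarRow_star`). [cite: Balaban1984PropagatorsII, (2.153) p.249, (2.3) p.224, Lemma 2.4 p.245, (2.35) p.228; Balaban1985BackgroundPropagators, (3.156)–(3.157) p.428] -/
theorem ineq2153_one_lettersYOfRecordV4_of_scalarRow_star_st (x : MemberY θ.d₆ θ.ℓ₆ θ.hd' θ.hL' θ.b₀ θ.b₁ Mstar')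
    (𝔢 : SectELettersY (Matrix (Fin N) (Fin N) ℂ) x) {γ : ℝ}
    (hrow : ∀ g : IBondY x.toKIdx → ℝ,
      (∀ q, ¬ (lvl x.hN x.D x.hk q = x.k ∧ (GoodY x (usrc x q) ∨ GoodY x (utgt x q))) → g q = 0) → (∀ q, IsAxialY x q → g q = 0) →
      (∀ c : USiteY x × Fin (θ.d₆ + 1), IsCornerY x c.1 → Q1Y x (avYOfRecord x) (fun _ _ => 1 : CfgY ℂ x.toKIdx) c (fun q => ((g q : ℝ) : ℂ)) = 0) →
        γ * ∑ q, g q ^ 2 ≤ etaDY x * ∑ q, g q * (onFun (EE (domT x.hN x.D x.hk) x.hcf x.hw) g q - x.toKIdx.w q * g q))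
    (B : IBondY x.toKIdx → Matrix (Fin N) (Fin N) ℂ) (hΛ : ∀ q, ¬ inΛstY x q → B q = 0) (hAx : ∀ q, IsAxialY x q → B q = 0)
    (hQ : ∀ c : CBondStY x, Q1Y x (avYOfRecord x) (fun _ _ => 1 : CfgY (Matrix (Fin N) (Fin N) ℂ) x.toKIdx) c.1 B = 0) :
    γ * trIP (fun _ => (1 : ℝ)) B B ≤ trIP (fun _ => (1 : ℝ)) B (deltaKPY x (lettersYOfRecordV4 N θ Mstar' 𝔯 x) 𝔢 (fun _ _ => 1) B) :=
  ineq2153_one_of_scalarRow_star_st x (lettersYOfRecordV4 N θ Mstar' 𝔯 x) 𝔢 _ (lettersYOfRecordV4_QG1Qinv_one_eq_liftEndY N θ Mstar' 𝔯 x)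
    hrow B hΛ hAx hQ

end StarNamed

end Literature.MathematicalPhysics.QuantumFieldTheory.Balaban1983to89.B1Eq324BenfattoClassSectEMemberIneq2153ScalarReductionAtNode00

end
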